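import Literature.NumberTheory.EllipticCurves.Kato2004.IwasawaH1ReductionNumberFieldSeparatedProofs
import HarnessLib

/-!
# Kato 2004 (Astérisque 295) §8.2 + §12.2 / Rubin App. B OVER A NUMBER FIELD `K`:
# `𝐇¹_{K,Γ}(T_pE) = lim←_{n,k} H¹(K_n, E[p^k])` — doubly compatible families of finite-level classes
# (trace maps in `n`, `p_*` in `k`) ARE the elements of the `K`-side Iwasawa cohomology `IwasawaH1DataOver`;
# integrality read on the reductions; Kőnig's lemma for the double tower — the `K`-TWIN, word for word,
# of `Kato2004/IwasawaH1TowerLimitProofs.lean`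

Topic `NumberTheory/EllipticCurves`, sub-directory `Kato2004` (namespace = path).  Cell `bsd-cm`, seat
`bsd-cm-k-ty1` g30 (literature-prover), row K2C-8 (C5) file T2b (second half) of the (C5-0) typing memo
`pub/bsd-cm/bsd-cm-k-ty1/g30/C5-typing-memo.md` (19c5e03c2b551001), planner ruling D1019 (B) Q2; crux
stmt-BirchSwinnertonDyer-19945 (`EllipticUnitValueSevenOfGZK`, route K7r): stage S5 of Kato's map (15.12.1)∘15.14 —
the Λ-adic elliptic-unit class in `H¹_Iw(Kℚ_∞/K, T_pE)` will be DEFINED as the unique element of the pinned datum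
whose reductions are the corestricted Kummer–cup classes `c_{n,k} ∈ H¹(Kℚ_n, E[p^k])`; THIS file is the sentence
«a doubly compatible integral family `(c_{n,k})` IS a unique element» (`IwasawaH1DataOver.existsUnique_of_compatible`).
THEOREMS ONLY (no definition, no named fact, no `sorry`, no instance, no notation).  Nothing about any particular
curve, CM or BSD is claimed; no summit statement is proved by this file.

## The printed statements

* K. Kato, Astérisque 295 (2004) **§8.2 [p. 181]** "`H^q(R, T) = lim←_n H^q(R, T/p^n)`"; **§12.2 [p. 220]**
  "`𝐇^q(T) = lim←_n H^q(ℤ[ζ_{p^n}, 1/p], T)` … the inverse limit is taken with respect to trace maps."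
  Together, over a number field `K` and a `ℤ_p`-extension `K_∞ = ⋃ K_n`:
  `H¹_Iw(K_∞/K, T) = lim←_{n,k} H¹(O_{K_n}[1/p], T/p^k)`.
* K. Rubin, *Euler Systems* (2000) **App. B Prop. B.2.3** (`H¹(G,T) = lim← H¹(G, T/p^n)`), **§B.3**
  ("`H¹_∞(K, T) = lim← H¹(F, T)`" over the finite layers `F ⊂ K_∞`, p. 228).
* D. Kőnig (1927) / Bourbaki, *Topologie générale* I §9.6 Prop. 8: an inverse system of non-empty finite sets has
  a non-empty inverse limit (Mathlib `nonempty_sections_of_finite_inverse_system`).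

## Contents (all PROVED), for an elliptic curve `E` over a number field `K`, a `ℤ_p`-extension `κ`, and the pinned
datum `IK : Kato2004.IwasawaH1DataOver E p κ γ`

* §1 `mem_integralH1K_iff_forall_reduceH1PkK_mem` — a class of `H¹(U, T_pE)` is integral (`CM.integralH1K`)
  iff all its reductions modulo `p^k` are (⇐ by separatedness on the subgroups `U ⊓ I_𝔓`).
* §2 `reduceTorsionH1_eq_mapH1AddHomK`, `reduceTorsionH1_layerCoresOver`, `reduceTorsionH1_layerCoresK`,
  `reduceTorsionH1_resLeK` — the transition maps `p_*` commute with the trace maps of the tower (both the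
  `ℤ_p`-layer form `layerCoresOver` and the two-open-subgroups form `CM.layerCores`) and with restriction.
* §3 **`exists_normCompatibleOver_of_compatible`** (+ `…_unique`): a family `c n k ∈ H¹(K_n, E[p^k])` compatible
  under `p_*` (in `k`) and under the trace maps (in `n`) is the family of reductions of a UNIQUE trace-compatible
  family `y_n ∈ H¹(K_n, T_pE)`; **`IwasawaH1DataOver.existsUnique_of_compatible`**: if moreover every `c n k` is
  integral, it is `(red_{p^k} (proj_n x))_{n,k}` for a unique `x ∈ 𝐇¹_{K,Γ}(T_pE)`.
* §4 **`exists_compatible_of_finite_nonemptyK`** (Kőnig for the double tower).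

## References
K. Kato, Astérisque 295 (2004) §8.2 (pp. 180–181), §12.2 (p. 220) [Kato2004Asterisque]; K. Rubin, *Euler Systems*
(2000) App. B §2 Prop. B.2.3, §B.3 [Rubin2000]; J. Neukirch, A. Schmidt, K. Wingberg (2008) II §7 (2.7.5), I §5
[NeukirchSchmidtWingberg2008]; B. Perrin-Riou, Bull. SMF 115 (1987) §0 [PerrinRiou1987BSMF]; tree: the ℚ-twin
`Kato2004/IwasawaH1TowerLimitProofs.lean` (mirrored line by line), `Kato2004/IwasawaH1ReductionNumberFieldSeparatedProofs.lean`
(B.2.3 both halves over `K`), `Kato2004/IwasawaH1ReductionPkNumberField.lean` (`reduceH1PkK_resLe/_layerCoresOver/_mem_integralH1K`),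
`Kato2004/IwasawaCohomologyNumberField.lean` (`IwasawaH1DataOver`, `layerCoresOver`, `IsNormCompatibleOver`),
`HeegnerModuleIndex.lean` (`reduceTorsionH1`), Mathlib `nonempty_sections_of_finite_inverse_system`,
`Functor.ofOpSequence`, `Nat.decreasingInduction`.
-/

noncomputable section

open scoped NumberField
open Field IsDedekindDomain CategoryTheory
open Literature.NumberTheory.GaloisRepresentations
open Literature.NumberTheory.EllipticCurves Literature.NumberTheory.EllipticCurves.Kato2004
open Literature.NumberTheory.EllipticCurves.Kato2004.CM (tateRepK integralH1K mem_integralH1K_iff)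
open WeierstrassCurve (geomPoints geomTorsion)

namespace Literature.NumberTheory.EllipticCurves.Kato2004

variable {K : Type} [Field K] (E : WeierstrassCurve K) [E.IsElliptic] (p : ℕ) [Fact p.Prime]

/-! ## §1 Integrality read on the reductions -/

section Integral

variable [ContinuousSMul ℤ_[p] (E.tateModule p)]

/-- **Integrality is read on the reductions**: `x ∈ H¹(O_F[1/p], T_pE)` (the class-level condition
`CM.integralH1K`: restriction to `U ⊓ I_𝔓` vanishes for every prime `𝔓 ∤ p` of `ℤ̄_K`) iff
`red_{p^k} x ∈ H¹(O_F[1/p], E[p^k])` for every `k`.  (⇒ `reduceH1PkK_mem_integralH1K`; ⇐ the reductions commute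
with restriction and `H¹(U ⊓ I_𝔓, T_pE)` is separated, `eq_zero_of_forall_reduceH1PkK_eq_zero`.)
[cite: Kato2004Asterisque, §8.2 and Lemma 8.5 (pp. 180–184)] [cite: Rubin2000, App. B Prop. B.2.3] -/
theorem mem_integralH1K_iff_forall_reduceH1PkK_mem (U : Subgroup (absoluteGaloisGroup K))
    (x : H1 (tateRepK E p) U) :
    x ∈ integralH1K (tateRepK E p) p U ↔
      ∀ k : ℕ, reduceH1PkK E p k U x ∈ integralH1K (E.torsionGaloisModule ((p : ℤ) ^ k)) p U := by
  refine ⟨fun hx k ↦ reduceH1PkK_mem_integralH1K E p k U hx, fun h ↦ ?_⟩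
  rw [mem_integralH1K_iff]
  intro v hv 𝔓 h𝔓
  refine eq_zero_of_forall_reduceH1PkK_eq_zero E p _ _ fun k ↦ ?_
  rw [reduceH1PkK_resLe]
  exact (mem_integralH1K_iff _ _ _ _).mp (h k) v hv 𝔓 h𝔓

end Integral

/-! ## §2 The transition maps `p_*` commute with the trace maps and with restriction -/

omit [E.IsElliptic] [Fact p.Prime] in
/-- `p_* = WeierstrassCurve.reduceTorsionH1` IS the change of coefficients `mapH1AddHom` along
`p • : E[p^{k+1}] → E[p^k]` (same map on cocycles). [cite: PerrinRiou1987BSMF, §0 (p. 401)] [cite: SerreGaloisCohomology1997, I §2.2] -/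
theorem reduceTorsionH1_eq_mapH1AddHomK (k : ℕ) (U : Subgroup (absoluteGaloisGroup K))
    (c : E.torsionH1Over ((p : ℤ) ^ (k + 1)) U) :
    E.reduceTorsionH1 p k U c =
      mapH1AddHom (subgroupRep (E.torsionGaloisModule ((p : ℤ) ^ (k + 1))).toTopRep U)
        (subgroupRep (E.torsionGaloisModule ((p : ℤ) ^ k)).toTopRep U) (E.geomTorsionReduce p k)
        continuous_of_discreteTopology (geomTorsionReduce_subgroupRepK E p k U) c := by
  obtain ⟨φ, rfl⟩ :=
    oneCocycleClass_surjective (subgroupRep (E.torsionGaloisModule ((p : ℤ) ^ (k + 1))).toTopRep U) c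
  rw [reduceTorsionH1_oneCocycleClassK, mapH1AddHom_oneCocycleClass]

omit [E.IsElliptic] [Fact p.Prime] in
/-- **`p_*` commutes with the trace map between two layers** `Cor : H¹(U, E[p^j]) → H¹(U', E[p^j])`, `U ≤ U'`
open (`CM.layerCores` of `EllipticZetaReciprocity.lean`): "Cor" is a morphism of cohomological functors.
[cite: NeukirchSchmidtWingberg2008, I §5] [cite: Kato2004Asterisque, §15.6 (p. 253)] -/
theorem reduceTorsionH1_layerCoresK [NumberField K] (k : ℕ) {U U' : Subgroup (absoluteGaloisGroup K)} (h : U ≤ U')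
    (hU : IsOpen (U : Set (absoluteGaloisGroup K))) (c : E.torsionH1Over ((p : ℤ) ^ (k + 1)) U) :
    E.reduceTorsionH1 p k U' (CM.layerCores (E.torsionGaloisModule ((p : ℤ) ^ (k + 1))) h hU c) =
      CM.layerCores (E.torsionGaloisModule ((p : ℤ) ^ k)) h hU (E.reduceTorsionH1 p k U c) := by
  refine (reduceTorsionH1_eq_mapH1AddHomK E p k _ _).trans ?_
  refine Eq.trans ?_ (congrArg (fun t ↦ CM.layerCores (E.torsionGaloisModule ((p : ℤ) ^ k)) h hU t)
    (reduceTorsionH1_eq_mapH1AddHomK E p k _ c).symm)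
  unfold CM.layerCores
  exact mapH1AddHom_coresLe (X := (E.torsionGaloisModule ((p : ℤ) ^ (k + 1))).toTopRep)
    (Y := (E.torsionGaloisModule ((p : ℤ) ^ k)).toTopRep) (H := U) (H' := U') (hF := _)
    (E.geomTorsionReduce p k) continuous_of_discreteTopology h hU
    (geomTorsionReduce_subgroupRepK E p k _) (geomTorsionReduce_subgroupRepK E p k _) c

omit [E.IsElliptic] in
/-- **`p_*` commutes with the trace maps** `Cor : H¹(K_{n+1}, E[p^j]) → H¹(K_n, E[p^j])` of a `ℤ_p`-extension `κ`
of `K` (`layerCoresOver`). [cite: NeukirchSchmidtWingberg2008, I §5] [cite: Kato2004Asterisque, §12.2 (p. 220)] -/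
theorem reduceTorsionH1_layerCoresOver (κ : ZpExtension K p) (n k : ℕ)
    (c : E.torsionH1Over ((p : ℤ) ^ (k + 1)) (κ.layerSubgroup (n + 1))) :
    E.reduceTorsionH1 p k (κ.layerSubgroup n)
        (layerCoresOver (E.torsionGaloisModule ((p : ℤ) ^ (k + 1))) κ n c) =
      layerCoresOver (E.torsionGaloisModule ((p : ℤ) ^ k)) κ n
        (E.reduceTorsionH1 p k (κ.layerSubgroup (n + 1)) c) := by
  refine (reduceTorsionH1_eq_mapH1AddHomK E p k _ _).trans ?_
  refine Eq.trans ?_ (congrArg (fun t ↦ layerCoresOver (E.torsionGaloisModule ((p : ℤ) ^ k)) κ n t)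
    (reduceTorsionH1_eq_mapH1AddHomK E p k _ c).symm)
  unfold layerCoresOver
  exact mapH1AddHom_coresLe (X := (E.torsionGaloisModule ((p : ℤ) ^ (k + 1))).toTopRep)
    (Y := (E.torsionGaloisModule ((p : ℤ) ^ k)).toTopRep) (H := κ.layerSubgroup (n + 1))
    (H' := κ.layerSubgroup n) (hF := _) (E.geomTorsionReduce p k) continuous_of_discreteTopology
    (κ.layerSubgroup_antitone (Nat.le_succ n)) (κ.isOpen_layerSubgroup (n + 1))
    (geomTorsionReduce_subgroupRepK E p k _) (geomTorsionReduce_subgroupRepK E p k _) c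

omit [E.IsElliptic] [Fact p.Prime] in
/-- **`p_*` commutes with restriction** `res : H¹(U', E[p^j]) → H¹(U, E[p^j])`, `U ≤ U'`.
[cite: SerreGaloisCohomology1997, I §2.4] -/
theorem reduceTorsionH1_resLeK (k : ℕ) {U U' : Subgroup (absoluteGaloisGroup K)} (h : U ≤ U')
    (c : E.torsionH1Over ((p : ℤ) ^ (k + 1)) U') :
    E.reduceTorsionH1 p k U (resLe (E.torsionGaloisModule ((p : ℤ) ^ (k + 1))).toTopRep h 1 c) =
      resLe (E.torsionGaloisModule ((p : ℤ) ^ k)).toTopRep h 1 (E.reduceTorsionH1 p k U' c) := by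
  refine (reduceTorsionH1_eq_mapH1AddHomK E p k _ _).trans ?_
  refine Eq.trans ?_ (congrArg (fun t ↦ resLe (E.torsionGaloisModule ((p : ℤ) ^ k)).toTopRep h 1 t)
    (reduceTorsionH1_eq_mapH1AddHomK E p k _ c).symm)
  exact mapH1AddHom_resLe (X := (E.torsionGaloisModule ((p : ℤ) ^ (k + 1))).toTopRep)
    (Y := (E.torsionGaloisModule ((p : ℤ) ^ k)).toTopRep) (H := U) (H' := U') (E.geomTorsionReduce p k)
    continuous_of_discreteTopology h (geomTorsionReduce_subgroupRepK E p k U)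
    (geomTorsionReduce_subgroupRepK E p k U') c

/-! ## §3 Doubly compatible finite-level families = trace-compatible `T_pE`-adic families -/

section Lift

variable [ContinuousSMul ℤ_[p] (E.tateModule p)] (κ : ZpExtension K p)

/-- **`lim←_n H¹(K_n, T_pE) = lim←_{n,k} H¹(K_n, E[p^k])` (existence)**: a family of classes `c n k ∈ H¹(K_n, E[p^k])`
compatible under `p_*` (in `k`) and under the trace maps `Cor` (in `n`) is the family of reductions of a family
`y_n ∈ H¹(K_n, T_pE)` compatible under the trace maps (Rubin B.2.3 at each layer; trace compatibility of the lifts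
holds modulo every `p^k` and `H¹(K_n, T_pE)` is separated). [cite: Rubin2000, App. B Prop. B.2.3 and §B.3]
[cite: Kato2004Asterisque, §8.2 (p. 181) and §12.2 (p. 220)] -/
theorem exists_normCompatibleOver_of_compatible [NumberField K]
    (c : ∀ n k : ℕ, E.torsionH1Over ((p : ℤ) ^ k) (κ.layerSubgroup n))
    (hk : ∀ n k, E.reduceTorsionH1 p k (κ.layerSubgroup n) (c n (k + 1)) = c n k)
    (hn : ∀ n k, layerCoresOver (E.torsionGaloisModule ((p : ℤ) ^ k)) κ n (c (n + 1) k) = c n k) :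
    ∃ y : ∀ n : ℕ, H1 (tateRepK E p) (κ.layerSubgroup n),
      (∀ n k, reduceH1PkK E p k (κ.layerSubgroup n) (y n) = c n k) ∧
      ∀ n, layerCoresOver (tateRepK E p) κ n (y (n + 1)) = y n := by
  choose y hy using fun n ↦ exists_reduceH1PkK_eq_of_compatible E p (κ.layerSubgroup n) (c n) (hk n)
  refine ⟨y, hy, fun n ↦ eq_of_forall_reduceH1PkK_eq E p _ fun k ↦ ?_⟩
  rw [reduceH1PkK_layerCoresOver, hy, hy]
  exact hn n k

/-- **Uniqueness** in `exists_normCompatibleOver_of_compatible`: the `T_pE`-adic family with prescribed reductions is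
unique, layer by layer (separatedness). [cite: Rubin2000, App. B Prop. B.2.3] -/
theorem normCompatibleOver_of_compatible_unique
    (c : ∀ n k : ℕ, E.torsionH1Over ((p : ℤ) ^ k) (κ.layerSubgroup n))
    {y y' : ∀ n : ℕ, H1 (tateRepK E p) (κ.layerSubgroup n)}
    (hy : ∀ n k, reduceH1PkK E p k (κ.layerSubgroup n) (y n) = c n k)
    (hy' : ∀ n k, reduceH1PkK E p k (κ.layerSubgroup n) (y' n) = c n k) : y = y' :=
  funext fun n ↦ eq_of_forall_reduceH1PkK_eq E p _ fun k ↦ by rw [hy, hy']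

variable {κ} {γ : absoluteGaloisGroup K} (IK : IwasawaH1DataOver E p κ γ)

/-- **`𝐇¹_{K,Γ}(T_pE) = lim←_{n,k} H¹(O_{K_n}[1/p], E[p^k])` on the pinned datum** (number field `K`): a doubly
compatible (trace maps in `n`, `p_*` in `k`) family of INTEGRAL classes `c n k ∈ H¹(O_{K_n}[1/p], E[p^k])` is
`(red_{p^k}(proj_n x))_{n,k}` for a UNIQUE `x ∈ 𝐇¹_{K,Γ}(T_pE)` (§3 existence + §1 integrality on the reductions +
the pin `proj_surjective`/`proj_injective`).  This is the sentence by which levelwise constructions over `K` (one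
class in each `H¹(K_n, E[p^k])`, compatible — e.g. corestricted Kummer–cup classes of elliptic units, Kato
(15.12.1)∘15.14) define Λ-adic classes. [cite: Kato2004Asterisque, §8.2 (p. 181), §12.2 (p. 220), (15.12.1) (p. 262)]
[cite: Rubin2000, App. B Prop. B.2.3 and §B.3] -/
theorem IwasawaH1DataOver.existsUnique_of_compatible [NumberField K]
    (c : ∀ n k : ℕ, E.torsionH1Over ((p : ℤ) ^ k) (κ.layerSubgroup n))
    (hk : ∀ n k, E.reduceTorsionH1 p k (κ.layerSubgroup n) (c n (k + 1)) = c n k)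
    (hn : ∀ n k, layerCoresOver (E.torsionGaloisModule ((p : ℤ) ^ k)) κ n (c (n + 1) k) = c n k)
    (hint : ∀ n k, c n k ∈ integralH1K (E.torsionGaloisModule ((p : ℤ) ^ k)) p (κ.layerSubgroup n)) :
    ∃! x : IK.H, ∀ n k, reduceH1PkK E p k (κ.layerSubgroup n) (IK.proj n x) = c n k := by
  obtain ⟨y, hy, hcor⟩ := exists_normCompatibleOver_of_compatible E p κ c hk hn
  have hyint : ∀ n, y n ∈ integralH1K (tateRepK E p) p (κ.layerSubgroup n) := fun n ↦
    (mem_integralH1K_iff_forall_reduceH1PkK_mem E p _ _).mpr fun k ↦ (hy n k).symm ▸ hint n k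
  obtain ⟨x, hx⟩ := IK.proj_surjective y ⟨hyint, hcor⟩
  refine ⟨x, fun n k ↦ by rw [hx, hy], fun x' hx' ↦ IK.proj_eq_iff.mp fun n ↦ ?_⟩
  rw [hx]
  exact eq_of_forall_reduceH1PkK_eq E p _ fun k ↦ by rw [hx', hy]

end Lift

/-! ## §4 Kőnig's lemma for the double tower `(H¹(K_n, E[p^k]))_{n,k}` -/

section Konig

variable (κ : ZpExtension K p)

omit [E.IsElliptic] in
/-- **Kőnig's lemma for the double tower.**  Let `S n k ⊆ H¹(K_n, E[p^k])` be FINITE sets, mapped into each other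
by the transition maps `p_*` and by the trace maps `Cor : H¹(K_{n+1}, E[p^k]) → H¹(K_n, E[p^k])`, with the diagonal
sets `S j j` non-empty.  Then there is a doubly compatible family `c n k ∈ S n k` (hence, by §3, a trace-compatible
`T_pE`-adic family / an element of `𝐇¹_{K,Γ}(T_pE)` when the classes are integral).  Proof verbatim the ℚ-twin:
compatible families on the squares `[0, j]²` form an inverse system of finite non-empty sets (non-empty by pushing an
element of `S j j` down the square, using `p_* ∘ Cor = Cor ∘ p_*`, §2); Kőnig gives a section.
[cite: Rubin2000, App. B §B.3 (p. 228)] [cite: Kato2004Asterisque, §12.2 (p. 220)] -/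
theorem exists_compatible_of_finite_nonemptyK
    (S : ∀ n k : ℕ, Set (E.torsionH1Over ((p : ℤ) ^ k) (κ.layerSubgroup n)))
    (hfin : ∀ n k, (S n k).Finite) (hne : ∀ j, (S j j).Nonempty)
    (hSk : ∀ n k, ∀ x ∈ S n (k + 1), E.reduceTorsionH1 p k (κ.layerSubgroup n) x ∈ S n k)
    (hSn : ∀ n k, ∀ x ∈ S (n + 1) k,
      layerCoresOver (E.torsionGaloisModule ((p : ℤ) ^ k)) κ n x ∈ S n k) :
    ∃ c : ∀ n k : ℕ, E.torsionH1Over ((p : ℤ) ^ k) (κ.layerSubgroup n),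
      (∀ n k, c n k ∈ S n k) ∧
      (∀ n k, E.reduceTorsionH1 p k (κ.layerSubgroup n) (c n (k + 1)) = c n k) ∧
      (∀ n k, layerCoresOver (E.torsionGaloisModule ((p : ℤ) ^ k)) κ n (c (n + 1) k) = c n k) := by
  classical
  -- truncated compatible families on the square `[0, j]²` (zero outside the square)
  let P : ℕ → (∀ n k : ℕ, E.torsionH1Over ((p : ℤ) ^ k) (κ.layerSubgroup n)) → Prop := fun j c ↦
    (∀ n k, n ≤ j → k ≤ j → c n k ∈ S n k) ∧
    (∀ n k, n + 1 ≤ j → k ≤ j →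
      layerCoresOver (E.torsionGaloisModule ((p : ℤ) ^ k)) κ n (c (n + 1) k) = c n k) ∧
    (∀ n k, n ≤ j → k + 1 ≤ j → E.reduceTorsionH1 p k (κ.layerSubgroup n) (c n (k + 1)) = c n k) ∧
    (∀ n k, ¬ (n ≤ j ∧ k ≤ j) → c n k = 0)
  let X : ℕ → Type := fun j ↦ {c // P j c}
  -- non-emptiness: push an element of `S j j` down the square
  have hX : ∀ j, Nonempty (X j) := by
    intro j
    obtain ⟨s, hs⟩ := hne j
    -- downward in `k` at layer `j`
    let r : ∀ k, k ≤ j → E.torsionH1Over ((p : ℤ) ^ k) (κ.layerSubgroup j) := fun k hk ↦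
      Nat.decreasingInduction
        (motive := fun k _ ↦ E.torsionH1Over ((p : ℤ) ^ k) (κ.layerSubgroup j))
        (fun k _ x ↦ E.reduceTorsionH1 p k (κ.layerSubgroup j) x) s hk
    have hr_self : r j le_rfl = s := Nat.decreasingInduction_self _ _
    have hr_succ : ∀ k (hk : k + 1 ≤ j),
        r k (Nat.le_of_succ_le hk) = E.reduceTorsionH1 p k (κ.layerSubgroup j) (r (k + 1) hk) :=
      fun k hk ↦ Nat.decreasingInduction_succ_left _ _ hk _
    have hr_mem : ∀ d k (hk : k ≤ j), k + d = j → r k hk ∈ S j k := by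
      intro d
      induction d with
      | zero =>
          intro k hk hkj
          obtain rfl : j = k := by omega
          rw [hr_self]
          exact hs
      | succ d ih =>
          intro k hk hkj
          have hk1 : k + 1 ≤ j := by omega
          rw [hr_succ k hk1]
          exact hSk j k _ (ih (k + 1) hk1 (by omega))
    -- then downward in `n`, for each `k ≤ j`
    let cc : ∀ k, k ≤ j → ∀ n, n ≤ j → E.torsionH1Over ((p : ℤ) ^ k) (κ.layerSubgroup n) :=
      fun k hk n hn ↦
        Nat.decreasingInduction
          (motive := fun n _ ↦ E.torsionH1Over ((p : ℤ) ^ k) (κ.layerSubgroup n))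
          (fun n _ x ↦ layerCoresOver (E.torsionGaloisModule ((p : ℤ) ^ k)) κ n x) (r k hk) hn
    have hcc_self : ∀ k (hk : k ≤ j), cc k hk j le_rfl = r k hk := fun k hk ↦
      Nat.decreasingInduction_self _ _
    have hcc_succ : ∀ k (hk : k ≤ j) n (hn : n + 1 ≤ j),
        cc k hk n (Nat.le_of_succ_le hn) =
          layerCoresOver (E.torsionGaloisModule ((p : ℤ) ^ k)) κ n (cc k hk (n + 1) hn) :=
      fun k hk n hn ↦ Nat.decreasingInduction_succ_left _ _ hn _
    have hcc_mem : ∀ k (hk : k ≤ j) d n (hn : n ≤ j), n + d = j → cc k hk n hn ∈ S n k := by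
      intro k hk d
      induction d with
      | zero =>
          intro n hn hnj
          obtain rfl : j = n := by omega
          rw [hcc_self]
          exact hr_mem (j - k) k hk (by omega)
      | succ d ih =>
          intro n hn hnj
          have hn1 : n + 1 ≤ j := by omega
          rw [hcc_succ k hk n hn1]
          exact hSn n k _ (ih (n + 1) hn1 (by omega))
    have hcc_red : ∀ k (hk : k + 1 ≤ j) d n (hn : n ≤ j), n + d = j →
        E.reduceTorsionH1 p k (κ.layerSubgroup n) (cc (k + 1) hk n hn) =
          cc k (Nat.le_of_succ_le hk) n hn := by
      intro k hk d
      induction d with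
      | zero =>
          intro n hn hnj
          obtain rfl : j = n := by omega
          rw [hcc_self, hcc_self]
          exact (hr_succ k hk).symm
      | succ d ih =>
          intro n hn hnj
          have hn1 : n + 1 ≤ j := by omega
          rw [hcc_succ (k + 1) hk n hn1, hcc_succ k (Nat.le_of_succ_le hk) n hn1,
            reduceTorsionH1_layerCoresOver, ih (n + 1) hn1 (by omega)]
    let c₀ : ∀ n k : ℕ, E.torsionH1Over ((p : ℤ) ^ k) (κ.layerSubgroup n) := fun n k ↦
      if h : n ≤ j ∧ k ≤ j then cc k h.2 n h.1 else 0
    refine ⟨⟨c₀, ?_, ?_, ?_, ?_⟩⟩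
    · intro n k hn hk
      simp only [c₀, dif_pos (And.intro hn hk)]
      exact hcc_mem k hk (j - n) n hn (by omega)
    · intro n k hn hk
      simp only [c₀, dif_pos (And.intro hn hk), dif_pos (And.intro (Nat.le_of_succ_le hn) hk)]
      exact (hcc_succ k hk n hn).symm
    · intro n k hn hk
      simp only [c₀, dif_pos (And.intro hn hk), dif_pos (And.intro hn (Nat.le_of_succ_le hk))]
      exact hcc_red k hk (j - n) n hn (by omega)
    · intro n k h
      simp only [c₀, dif_neg h]
  -- the restriction maps `[0, j+1]² → [0, j]²`
  let trunc : ℕ → (∀ n k : ℕ, E.torsionH1Over ((p : ℤ) ^ k) (κ.layerSubgroup n)) →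
      (∀ n k : ℕ, E.torsionH1Over ((p : ℤ) ^ k) (κ.layerSubgroup n)) :=
    fun j c n k ↦ if n ≤ j ∧ k ≤ j then c n k else 0
  have htruncP : ∀ (j : ℕ) (c : X (j + 1)), P j (trunc j c.1) := by
    intro j c
    obtain ⟨h1, h2, h3, h4⟩ := c.2
    refine ⟨?_, ?_, ?_, ?_⟩
    · intro n k hn hk
      simp only [trunc, if_pos (And.intro hn hk)]
      exact h1 n k (by omega) (by omega)
    · intro n k hn hk
      simp only [trunc, if_pos (And.intro hn hk), if_pos (And.intro (Nat.le_of_succ_le hn) hk)]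
      exact h2 n k (by omega) (by omega)
    · intro n k hn hk
      simp only [trunc, if_pos (And.intro hn hk), if_pos (And.intro hn (Nat.le_of_succ_le hk))]
      exact h3 n k (by omega) (by omega)
    · intro n k h
      simp only [trunc, if_neg h]
  let f₀ : ∀ j, X (j + 1) → X j := fun j c ↦ ⟨trunc j c.1, htruncP j c⟩
  let f : ∀ j, X (j + 1) ⟶ X j := fun j ↦ TypeCat.ofHom (f₀ j)
  let F : ℕᵒᵖ ⥤ Type := Functor.ofOpSequence (X := X) f
  haveI : ∀ j : ℕᵒᵖ, Finite (F.obj j) := fun j ↦ by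
    change Finite (X j.unop)
    haveI : ∀ n k, Finite (S n k) := fun n k ↦ (hfin n k).to_subtype
    let ι : X j.unop → (∀ a b : Fin (j.unop + 1), S a b) := fun c a b ↦
      ⟨c.1 a b, c.2.1 a b (Nat.le_of_lt_succ a.2) (Nat.le_of_lt_succ b.2)⟩
    refine Finite.of_injective ι fun c c' h ↦ Subtype.ext (funext fun n ↦ funext fun k ↦ ?_)
    by_cases hnk : n ≤ j.unop ∧ k ≤ j.unop
    · have h' := congrArg
        (fun g : (∀ a b : Fin (j.unop + 1), S a b) ↦
          ((g ⟨n, Nat.lt_succ_of_le hnk.1⟩ ⟨k, Nat.lt_succ_of_le hnk.2⟩ : S n k) :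
            E.torsionH1Over ((p : ℤ) ^ k) (κ.layerSubgroup n))) h
      exact h'
    · rw [c.2.2.2.2 n k hnk, c'.2.2.2.2 n k hnk]
  haveI : ∀ j : ℕᵒᵖ, Nonempty (F.obj j) := fun j ↦ hX j.unop
  -- Kőnig
  obtain ⟨u, hu⟩ := nonempty_sections_of_finite_inverse_system F
  have hstep : ∀ j n k, n ≤ j → k ≤ j →
      ((u (Opposite.op (j + 1)) : X (j + 1)).1 n k = (u (Opposite.op j) : X j).1 n k) := by
    intro j n k hn hk
    have h := hu (homOfLE (Nat.le_add_right j 1)).op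
    rw [Functor.ofOpSequence_map_homOfLE_succ] at h
    have h' : (if n ≤ j ∧ k ≤ j then (u (Opposite.op (j + 1)) : X (j + 1)).1 n k else 0) =
        (u (Opposite.op j) : X j).1 n k :=
      congrArg (fun c : X j ↦ c.1 n k) h
    rwa [if_pos (And.intro hn hk)] at h'
  have hstable : ∀ j j', j ≤ j' → ∀ n k, n ≤ j → k ≤ j →
      ((u (Opposite.op j') : X j').1 n k = (u (Opposite.op j) : X j).1 n k) := by
    intro j j' hjj'
    induction j', hjj' using Nat.le_induction with
    | base => intro n k _ _; rfl
    | succ j' hjj' ih =>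
        intro n k hn hk
        rw [hstep j' n k (hn.trans hjj') (hk.trans hjj'), ih n k hn hk]
  refine ⟨fun n k ↦ (u (Opposite.op (n + k)) : X (n + k)).1 n k, fun n k ↦ ?_, fun n k ↦ ?_,
    fun n k ↦ ?_⟩
  · exact (u (Opposite.op (n + k)) : X (n + k)).2.1 n k (Nat.le_add_right n k) (Nat.le_add_left k n)
  · rw [(u (Opposite.op (n + (k + 1))) : X (n + (k + 1))).2.2.2.1 n k (Nat.le_add_right n (k + 1))
      (Nat.le_add_left (k + 1) n)]
    exact hstable (n + k) (n + (k + 1)) (by omega) n k (Nat.le_add_right n k) (Nat.le_add_left k n)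
  · rw [(u (Opposite.op (n + 1 + k)) : X (n + 1 + k)).2.2.1 n k (Nat.le_add_right (n + 1) k)
      (Nat.le_add_left k (n + 1))]
    exact hstable (n + k) (n + 1 + k) (by omega) n k (Nat.le_add_right n k) (Nat.le_add_left k n)

end Konig

end Literature.NumberTheory.EllipticCurves.Kato2004

end
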